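import Literature.IUT.LogVolume.Corollary22Thm110LegendreWindowWitness
import Literature.IUT.LogVolume.Corollary22PartI
import Mathlib.NumberTheory.Bertrand
import HarnessLib

/-!
# [IUTchIV] Cor. 2.2 (ii): the `λ_k = 1/2 + 2/7^k` family — ADMISSIBLE PAIRS `(λ_k, l)` WITH THE PRIME `l = O(k)`,
# and the exact pole order `ord_7 j(λ_k) = −2k`, as PUBLIC theorems

S. Mochizuki, *Inter-universal Teichmüller theory IV*, RIMS manuscript (Apr. 2020) = PRIMS **57** (2021),
Cor. 2.2 (ii), proof (P1)–(P7) pp. 45–46 [claim: Mochizuki2012, status: disputed] (claim key, D-0012; the content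
of THIS file is classical arithmetic of the `λ`-line: valuations and the naive height of `j(λ_k)`, Bertrand's
postulate); S. Mochizuki, *Arithmetic elliptic curves in general position*, Math. J. Okayama Univ. **52** (2010),
Ex. 1.3 (i) p. 5 [cite: MochizukiGenEll2010, Ex 1.3 (i) p.5].

Proof-only sequel (cell abc-iut, seat abc-iut-w5-d044 gen 6; brick «H0» for abc-iut-C-cert-1's «HEX-KERNEL» assembly
(H5) of `Conditional.not_hSH_v6K_of_exists_deep`, STATUS 2026-08-26T10:57:55Z). The tree's non-vacuity witnesses
(`Corollary22Thm110LegendreWitness.lean`, abc-iut-S-d3 / w5-d054) give admissible `(P, l)` for the Theorem-1.10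
interface with `P = ratPoint λ_k` HIDDEN behind an existential and `l` either ABOVE `log(q^∀)/log 2` with no upper
bound or inside the (P1) window; the exact pole order `ord_7 j(λ_k) = −2k` is proved there only PRIVATELY. The
HEX-KERNEL assembly needs, BY NAME: (a) the pole order at `7` for the EXPLICIT point `ratPoint λ_k` (brick H4: the
chosen realising q-idele has `‖t_q(x₀)‖ = 7^{−k/l}` at every `x₀ | 7`); (b) an UPPER bound on `log(q^∀(λ_k))`, linear in
`k`; (c) for every large `k` an admissible prime `l` with `11 ≤ l ≤ 60·k` (so `log l ≤ log k + O(1)` against the depth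
threshold `k ≳ const + O(log l)`). This file supplies exactly these:

* `Cor22.ord_natGenerator_eq_one` — `ord_v(p_v) = 1` at every finite place `v` of `ℚ`;
* `Cor22.jInv_lamSeven_eq`, `Cor22.ord_jInv_lamSeven` — `j(λ_k) = 2^6(3·7^{2k}+16)^3/((7^k+4)^2(7^k−4)^2·7^{2k})` and
  **`ord_v j(λ_k) = −2k`** at the place over `7` (`k ≥ 1`) — `P = ratPoint λ_k` has `P.F = ℚ`, `P.x = λ_k` definitionally;
* `Cor22.logQForall_ratPoint_lamSeven_le` — **`log(q^∀(λ_k)) ≤ 6k·log 7 + 12·log 2`** (via `logQForall_le_htInfty` and the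
  naive height of the displayed fraction), complementing the tree's lower bound `2k·log 7 ≤ log(q^∀(λ_k))`;
* `Cor22.exists_admissible_prime_ratPoint_lamSeven` — **∃ k₀ ∀ k ≥ k₀ ∃ l prime, `11 ≤ l ≤ 60k`, with
  `ratPoint λ_k ∈ UP ∩ K_V ∩ U^{≤1}` (`K_V = CBData.std {2}`), `AdmitsCore`, `CondP2`, `CondP5`, `CondP6`** — the prime from
  Bertrand's postulate in `(N, 2N]`, `N = ⌈log(q^∀)/log 2⌉` ((P2) by `condP2_of_lt`), (P5) at the place over `7`, (P6) by
  the tree's proved (P4) ⟹ (P6) `condP6_of_seven_le` above its threshold `H_K` (whence `k₀`);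
* `Cor22.exists_nat_forall_affine_log_le` — the real-analysis line `A + B·log x ≤ k` for `0 < x ≤ c·k`, all large `k`.

No definitions, no new named fact; nothing here bears on the disputed [IUTchIII] Cor. 3.12 or asserts any clause of
Cor. 2.2; typed ≠ proved.
-/

noncomputable section

namespace Literature.IUT.LogVolume

namespace Cor22

open NumberField IsDedekindDomain
open Literature.NumberTheory.DiophantineGeometry Literature.NumberTheory.DiophantineGeometry.GenEll

/-! ## Valuations at the places of `ℚ` -/

/-- **`ord_v(p_v) = 1`**: the prime under a finite place `v` of `ℚ` is a uniformizer (`v = (p_v)`,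
`UniformABCConjecture.asIdeal_eq_span_natGenerator`, and Mathlib's `intValuation_singleton`): the normalisation
«`ord_K(π) = 1`» of the tree's `ord` at the places of `ℚ`. [cite: DupuyHilado2025, §2.4.2] -/
theorem ord_natGenerator_eq_one (v : HeightOneSpectrum (𝓞 ℚ)) :
    ord ℚ v (Rat.HeightOneSpectrum.natGenerator v : ℚ) = 1 := by
  have hp0 : (Rat.HeightOneSpectrum.natGenerator v : 𝓞 ℚ) ≠ 0 := by
    exact_mod_cast (Rat.HeightOneSpectrum.prime_natGenerator v).ne_zero
  have hval : v.valuation ℚ (algebraMap (𝓞 ℚ) ℚ (Rat.HeightOneSpectrum.natGenerator v : 𝓞 ℚ)) =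
      WithZero.exp (-1 : ℤ) := by
    rw [HeightOneSpectrum.valuation_of_algebraMap]
    exact HeightOneSpectrum.intValuation_singleton _ hp0 (UniformABCConjecture.asIdeal_eq_span_natGenerator v)
  rw [map_natCast] at hval
  unfold ord
  rw [hval, WithZero.log_exp, neg_neg]

/-- For every prime `p` there is a finite place of `ℚ` over it (Mathlib `Rat.HeightOneSpectrum.primesEquiv`).
[folklore] -/
private theorem exists_place_natGenerator_eq' {p : ℕ} (hp : p.Prime) :
    ∃ v : HeightOneSpectrum (𝓞 ℚ), Rat.HeightOneSpectrum.natGenerator v = p :=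
  ⟨(Rat.HeightOneSpectrum.primesEquiv (R := 𝓞 ℚ)).symm ⟨p, hp⟩,
    congrArg Subtype.val ((Rat.HeightOneSpectrum.primesEquiv (R := 𝓞 ℚ)).apply_symm_apply ⟨p, hp⟩)⟩

/-- A natural number prime to the prime under `v` has `ord_v = 0`. [folklore] -/
private theorem ord_natCast_eq_zero_of_not_dvd' (v : HeightOneSpectrum (𝓞 ℚ)) {n : ℕ}
    (h : ¬ Rat.HeightOneSpectrum.natGenerator v ∣ n) : ord ℚ v (n : ℚ) = 0 := by
  unfold ord
  rw [(UniformABCConjecture.valuation_natCast_eq_one_iff v n).2 h, WithZero.log_one, neg_zero]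

/-! ## The point `λ_k = 1/2 + 2/7^k`: the `j`-invariant and its pole at `7` -/

/-- `7 ∤ 7^k + 4` (`k ≥ 1`). [folklore] -/
private theorem not_seven_dvd_pow_add_four' {k : ℕ} (hk : 1 ≤ k) : ¬ 7 ∣ 7 ^ k + 4 := fun h => by
  have : 7 ∣ 4 := (Nat.dvd_add_right (dvd_pow_self 7 (by omega : k ≠ 0))).1 h
  omega

/-- `7 ∤ 7^k − 4` (`k ≥ 1`). [folklore] -/
private theorem not_seven_dvd_pow_sub_four' {k : ℕ} (hk : 1 ≤ k) : ¬ 7 ∣ 7 ^ k - 4 := fun h => by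
  have hle : 7 ≤ 7 ^ k := by simpa using Nat.pow_le_pow_right (by norm_num : 1 ≤ 7) hk
  have : 7 ∣ 7 ^ k - (7 ^ k - 4) := Nat.dvd_sub (dvd_pow_self 7 (by omega : k ≠ 0)) h
  rw [Nat.sub_sub_self (by omega : 4 ≤ 7 ^ k)] at this
  omega

/-- `7 ∤ 3·7^(2k) + 16` (`k ≥ 1`). [folklore] -/
private theorem not_seven_dvd_three_mul_pow_add' {k : ℕ} (hk : 1 ≤ k) :
    ¬ 7 ∣ 3 * 7 ^ (2 * k) + 16 := fun h => by
  have : 7 ∣ 16 := (Nat.dvd_add_right ((dvd_pow_self 7 (by omega : 2 * k ≠ 0)).mul_left 3)).1 h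
  omega

/-- **`j(λ_k) = 2^6·(3·7^{2k} + 16)^3 / ((7^k + 4)^2·(7^k − 4)^2·7^{2k})`** for `λ_k = 1/2 + 2/7^k`, `k ≥ 1`
(public form of the computation in `Corollary22Thm110LegendreWitness.lean`, abc-iut-S-d3): the `j`-invariant
`j = 2^8(λ²−λ+1)³/(λ²(λ−1)²)` of the Legendre curve at the (P5)-witness point. [cite: Mochizuki2012, IUTchIV Cor 2.2 (ii) proof (P5) p.46] -/
theorem jInv_lamSeven_eq {k : ℕ} (hk : 1 ≤ k) :
    jInv ((2 : ℚ)⁻¹ + 2 / 7 ^ k) =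
      ((64 * (3 * 7 ^ (2 * k) + 16) ^ 3 : ℕ) : ℚ) /
        ((((7 ^ k + 4) ^ 2 * (7 ^ k - 4) ^ 2 : ℕ) : ℚ) * (7 : ℚ) ^ (2 * k)) := by
  -- adapted from the private `jInv_lam_eq` of Corollary22Thm110LegendreWitness.lean (abc-iut-S-d3)
  have hle : 7 ≤ 7 ^ k := by simpa using Nat.pow_le_pow_right (by norm_num : 1 ≤ 7) hk
  have hx : (7 : ℚ) ^ k ≠ 0 := pow_ne_zero _ (by norm_num)
  have h4 : (7 : ℚ) ^ k - 4 ≠ 0 := by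
    have : ((7 ^ k : ℕ) : ℚ) - 4 ≠ 0 := by
      have h' : (7 : ℚ) ≤ ((7 ^ k : ℕ) : ℚ) := by exact_mod_cast hle
      intro h0; linarith
    simpa using this
  have h5 : (7 : ℚ) ^ k + 4 ≠ 0 := by positivity
  have hn1 : ((64 * (3 * 7 ^ (2 * k) + 16) ^ 3 : ℕ) : ℚ) = 64 * (3 * (7 : ℚ) ^ (2 * k) + 16) ^ 3 := by
    push_cast; ring
  have hn2 : (((7 ^ k + 4) ^ 2 * (7 ^ k - 4) ^ 2 : ℕ) : ℚ) = ((7 : ℚ) ^ k + 4) ^ 2 * ((7 : ℚ) ^ k - 4) ^ 2 := by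
    rw [Nat.cast_mul, Nat.cast_pow, Nat.cast_pow, Nat.cast_sub (by omega : 4 ≤ 7 ^ k)]
    push_cast; ring
  have hA : ((2 : ℚ)⁻¹ + 2 / 7 ^ k) ^ 2 - ((2 : ℚ)⁻¹ + 2 / 7 ^ k) + 1 =
      (3 * 7 ^ (2 * k) + 16) / (4 * 7 ^ (2 * k)) := by
    field_simp; ring
  have hB : ((2 : ℚ)⁻¹ + 2 / 7 ^ k) ^ 2 * (((2 : ℚ)⁻¹ + 2 / 7 ^ k) - 1) ^ 2 =
      (7 ^ k + 4) ^ 2 * (7 ^ k - 4) ^ 2 / (16 * 7 ^ (4 * k)) := by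
    field_simp; ring
  rw [hn1, hn2]
  unfold jInv
  rw [hA, hB]
  field_simp
  ring

/-- **`ord_v j(λ_k) = −2k`** at the place `v` of `ℚ` over `7` (`k ≥ 1`): `7` divides neither `3·7^{2k}+16` nor
`7^k ± 4`, and `ord_v(7) = 1` — the local height `h_7 = 2k` of the (P5) bad place of `λ_k` (p. 44: `h_v` = the order
of the `q`-parameter `= −ord_v(j)`). (Public, exact form of the private `ord_jInv_lam` of `Corollary22Thm110LegendreWitness.lean`.)
[cite: Mochizuki2012, IUTchIV Cor 2.2 (ii) proof (P5) p.46] -/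
theorem ord_jInv_lamSeven (v : HeightOneSpectrum (𝓞 ℚ)) (hv : Rat.HeightOneSpectrum.natGenerator v = 7)
    {k : ℕ} (hk : 1 ≤ k) :
    ord ℚ v (jInv ((2 : ℚ)⁻¹ + 2 / 7 ^ k)) = -(2 * k : ℤ) := by
  -- adapted from the private `ord_jInv_lam` of Corollary22Thm110LegendreWitness.lean (abc-iut-S-d3)
  have h7p : Nat.Prime 7 := by norm_num
  have hle : 7 ≤ 7 ^ k := by simpa using Nat.pow_le_pow_right (by norm_num : 1 ≤ 7) hk
  have hA : ¬ Rat.HeightOneSpectrum.natGenerator v ∣ 64 * (3 * 7 ^ (2 * k) + 16) ^ 3 := by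
    rw [hv]; intro h
    rcases (Nat.Prime.dvd_mul h7p).1 h with h | h
    · omega
    · exact not_seven_dvd_three_mul_pow_add' hk (Nat.Prime.dvd_of_dvd_pow h7p h)
  have hB : ¬ Rat.HeightOneSpectrum.natGenerator v ∣ (7 ^ k + 4) ^ 2 * (7 ^ k - 4) ^ 2 := by
    rw [hv]; intro h
    rcases (Nat.Prime.dvd_mul h7p).1 h with h | h
    · exact not_seven_dvd_pow_add_four' hk (Nat.Prime.dvd_of_dvd_pow h7p h)
    · exact not_seven_dvd_pow_sub_four' hk (Nat.Prime.dvd_of_dvd_pow h7p h)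
  have hA0 : ((64 * (3 * 7 ^ (2 * k) + 16) ^ 3 : ℕ) : ℚ) ≠ 0 := by positivity
  have hB0 : (((7 ^ k + 4) ^ 2 * (7 ^ k - 4) ^ 2 : ℕ) : ℚ) ≠ 0 := by
    have : (7 ^ k + 4) ^ 2 * (7 ^ k - 4) ^ 2 ≠ 0 :=
      mul_ne_zero (pow_ne_zero _ (by omega)) (pow_ne_zero _ (by omega))
    exact_mod_cast this
  have h70 : (7 : ℚ) ^ (2 * k) ≠ 0 := pow_ne_zero _ (by norm_num)
  have h7 : ord ℚ v (7 : ℚ) = 1 := by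
    have := ord_natGenerator_eq_one v
    rwa [hv, Nat.cast_ofNat] at this
  rw [jInv_lamSeven_eq hk, div_eq_mul_inv, ord_mul ℚ v hA0 (inv_ne_zero (mul_ne_zero hB0 h70)), ord_inv,
    ord_mul ℚ v hB0 h70, ord_pow, ord_natCast_eq_zero_of_not_dvd' v hA, ord_natCast_eq_zero_of_not_dvd' v hB, h7]
  push_cast
  ring

/-- `ord_v j(λ_k) < 0` at the place over `7`: a pole of `j`, i.e. the place over `7 ∤ 2l` is in `𝕍^bad_mod` ((P5)).
[cite: Mochizuki2012, IUTchIV Cor 2.2 (ii) proof (P5) p.46] -/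
theorem ord_jInv_lamSeven_neg (v : HeightOneSpectrum (𝓞 ℚ)) (hv : Rat.HeightOneSpectrum.natGenerator v = 7)
    {k : ℕ} (hk : 1 ≤ k) : ord ℚ v (jInv ((2 : ℚ)⁻¹ + 2 / 7 ^ k)) < 0 := by
  rw [ord_jInv_lamSeven v hv hk]
  have : (1 : ℤ) ≤ k := by exact_mod_cast hk
  omega

/-- `λ_k = 1/2 + 2/7^k ≠ 0, 1` (`k ≥ 1`): the point lies in `U_P = ℙ¹ ∖ {0, 1, ∞}`. [cite: MochizukiGenEll2010, Ex 1.3 (i) p.5] -/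
theorem lamSeven_ne {k : ℕ} (hk : 1 ≤ k) :
    ((2 : ℚ)⁻¹ + 2 / 7 ^ k) ≠ 0 ∧ ((2 : ℚ)⁻¹ + 2 / 7 ^ k) ≠ 1 := by
  have h1 : (0 : ℚ) < 2 / 7 ^ k := by positivity
  have h7k : (7 : ℚ) ≤ 7 ^ k := by exact_mod_cast Nat.le_self_pow (by omega : k ≠ 0) 7
  have h2 : (2 : ℚ) / 7 ^ k ≤ 2 / 7 := div_le_div_of_nonneg_left (by norm_num) (by norm_num) h7k
  constructor <;> intro h <;> linarith

/-- `ratPoint λ_k ∈ U_X(ℚ̄)` (minimally presented over `ℚ`, `λ_k ≠ 0, 1`). [cite: MochizukiGenEll2010, Ex 1.3 (i) p.5] -/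
theorem ratPoint_lamSeven_mem_UP {k : ℕ} (hk : 1 ≤ k) : ratPoint ((2 : ℚ)⁻¹ + 2 / 7 ^ k) ∈ UP :=
  UPle_subset_UP 1 (ratPoint_mem_UPle_one (lamSeven_ne hk).1 (lamSeven_ne hk).2)

/-! ## The height of `λ_k` from above -/

/-- Numerator bound: `2^6·(3·7^{2k}+16)^3 ≤ 2^{12}·7^{6k}` (`k ≥ 1`, as `16 ≤ 7^{2k}`). [folklore] -/
private theorem numer_le {k : ℕ} (hk : 1 ≤ k) : 64 * (3 * 7 ^ (2 * k) + 16) ^ 3 ≤ 4096 * 7 ^ (6 * k) := by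
  have h49 : 49 ≤ 7 ^ (2 * k) := by
    calc (49 : ℕ) = 7 ^ 2 := by norm_num
      _ ≤ 7 ^ (2 * k) := Nat.pow_le_pow_right (by norm_num) (by omega)
  have h1 : 3 * 7 ^ (2 * k) + 16 ≤ 4 * 7 ^ (2 * k) := by omega
  have h2 : (3 * 7 ^ (2 * k) + 16) ^ 3 ≤ (4 * 7 ^ (2 * k)) ^ 3 := Nat.pow_le_pow_left h1 3
  have h3 : (4 * 7 ^ (2 * k)) ^ 3 = 64 * 7 ^ (6 * k) := by
    rw [mul_pow, ← pow_mul, show 2 * k * 3 = 6 * k by ring]; norm_num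
  calc 64 * (3 * 7 ^ (2 * k) + 16) ^ 3 ≤ 64 * (4 * 7 ^ (2 * k)) ^ 3 := Nat.mul_le_mul_left 64 h2
    _ = 4096 * 7 ^ (6 * k) := by rw [h3]; ring

/-- Denominator bound: `(7^k+4)^2·(7^k−4)^2·7^{2k} ≤ 7^{6k}` (`k ≥ 1`). [folklore] -/
private theorem denom_le {k : ℕ} (hk : 1 ≤ k) : (7 ^ k + 4) ^ 2 * (7 ^ k - 4) ^ 2 * 7 ^ (2 * k) ≤ 7 ^ (6 * k) := by
  have hle : 7 ≤ 7 ^ k := by simpa using Nat.pow_le_pow_right (by norm_num : 1 ≤ 7) hk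
  have h1 : (7 ^ k + 4) * (7 ^ k - 4) ≤ 7 ^ k * 7 ^ k := by
    zify [(by omega : 4 ≤ 7 ^ k)]
    nlinarith
  have h2 : (7 ^ k + 4) ^ 2 * (7 ^ k - 4) ^ 2 ≤ (7 ^ k * 7 ^ k) ^ 2 := by
    rw [← mul_pow]; exact Nat.pow_le_pow_left h1 2
  calc (7 ^ k + 4) ^ 2 * (7 ^ k - 4) ^ 2 * 7 ^ (2 * k) ≤ (7 ^ k * 7 ^ k) ^ 2 * 7 ^ (2 * k) :=
      Nat.mul_le_mul_right _ h2
    _ = 7 ^ (6 * k) := by rw [← pow_add, ← pow_mul, ← pow_add]; ring_nf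

/-- **`log(q^∀(λ_k)) ≤ 6k·log 7 + 12·log 2`** (`k ≥ 1`): `log(q^∀) ≤ ht_∞ = h(j(λ_k))` (`logQForall_le_htInfty`, degree `1`)
and the naive height of the displayed fraction `j(λ_k) = 2^6(3·7^{2k}+16)^3/((7^k+4)^2(7^k−4)^2 7^{2k})` is at most
`log(2^{12}·7^{6k})` (numerator and denominator in lowest terms divide the displayed ones). [claim: Mochizuki2012, status: disputed] -/
theorem logQForall_ratPoint_lamSeven_le {k : ℕ} (hk : 1 ≤ k) :
    logQForall (ratPoint ((2 : ℚ)⁻¹ + 2 / 7 ^ k)) ≤ 6 * k * Real.log 7 + 12 * Real.log 2 := by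
  refine (logQForall_le_htInfty _).trans ?_
  unfold htInfty
  rw [degree_ratPoint, Nat.cast_one, inv_one, one_mul]
  change Height.logHeight₁ (jInv ((2 : ℚ)⁻¹ + 2 / 7 ^ k)) ≤ _
  rw [Rat.logHeight₁_eq_log_max]
  set A : ℕ := 64 * (3 * 7 ^ (2 * k) + 16) ^ 3 with hAdef
  set D : ℕ := (7 ^ k + 4) ^ 2 * (7 ^ k - 4) ^ 2 * 7 ^ (2 * k) with hDdef
  have hle : 7 ≤ 7 ^ k := by simpa using Nat.pow_le_pow_right (by norm_num : 1 ≤ 7) hk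
  have hA0 : A ≠ 0 := by positivity
  have hD0 : D ≠ 0 := mul_ne_zero (mul_ne_zero (pow_ne_zero _ (by omega)) (pow_ne_zero _ (by omega)))
    (pow_ne_zero _ (by norm_num))
  have hj : jInv ((2 : ℚ)⁻¹ + 2 / 7 ^ k) = Rat.divInt (A : ℤ) (D : ℤ) := by
    rw [Rat.divInt_eq_div, Int.cast_natCast, Int.cast_natCast, hAdef, hDdef, jInv_lamSeven_eq hk,
      Nat.cast_mul (((7 ^ k + 4) ^ 2 * (7 ^ k - 4) ^ 2 : ℕ)) (7 ^ (2 * k)), Nat.cast_pow 7 (2 * k)]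
    norm_num
  have hnum : (jInv ((2 : ℚ)⁻¹ + 2 / 7 ^ k)).num.natAbs ≤ A := by
    rw [hj]
    have h := Rat.num_dvd (A : ℤ) (b := (D : ℤ)) (by exact_mod_cast hD0)
    have h' : (Rat.divInt (A : ℤ) (D : ℤ)).num.natAbs ∣ A := by
      have := Int.natAbs_dvd_natAbs.2 h
      simpa using this
    exact Nat.le_of_dvd (Nat.pos_of_ne_zero hA0) h'
  have hden : (jInv ((2 : ℚ)⁻¹ + 2 / 7 ^ k)).den ≤ D := by
    rw [hj]
    have h := Rat.den_dvd (A : ℤ) (D : ℤ)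
    have h' : (Rat.divInt (A : ℤ) (D : ℤ)).den ∣ D := by exact_mod_cast h
    exact Nat.le_of_dvd (Nat.pos_of_ne_zero hD0) h'
  have hmax : max (jInv ((2 : ℚ)⁻¹ + 2 / 7 ^ k)).num.natAbs (jInv ((2 : ℚ)⁻¹ + 2 / 7 ^ k)).den ≤
      4096 * 7 ^ (6 * k) :=
    max_le (hnum.trans (numer_le hk)) (hden.trans ((denom_le hk).trans (Nat.le_mul_of_pos_left _ (by norm_num))))
  have hpos : (0 : ℝ) < ((max (jInv ((2 : ℚ)⁻¹ + 2 / 7 ^ k)).num.natAbs (jInv ((2 : ℚ)⁻¹ + 2 / 7 ^ k)).den : ℕ) : ℝ) := by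
    have : 0 < (jInv ((2 : ℚ)⁻¹ + 2 / 7 ^ k)).den := Rat.den_pos _
    exact_mod_cast lt_max_of_lt_right this
  calc Real.log ((max (jInv ((2 : ℚ)⁻¹ + 2 / 7 ^ k)).num.natAbs (jInv ((2 : ℚ)⁻¹ + 2 / 7 ^ k)).den : ℕ) : ℝ)
      ≤ Real.log ((4096 * 7 ^ (6 * k) : ℕ) : ℝ) := Real.log_le_log hpos (by exact_mod_cast hmax)
    _ = 6 * k * Real.log 7 + 12 * Real.log 2 := by
      rw [show ((4096 * 7 ^ (6 * k) : ℕ) : ℝ) = (2 : ℝ) ^ 12 * 7 ^ (6 * k) by push_cast; ring,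
        Real.log_mul (by positivity) (by positivity), Real.log_pow, Real.log_pow]
      push_cast
      ring

/-! ## A real-analysis line for the depth threshold -/

/-- **`A + B·log x ≤ k` for all `0 < x ≤ c·k`, eventually in `k`** (`B ≥ 0`, `c > 0`): the one real-analysis line of the
HEX-KERNEL assembly («`k ≳ const + O(log l)` with `l ≤ 60k` holds for all large `k`»), via `log y ≤ 2(√y − 1)`.
Explicit threshold: `k ≥ ⌈16B²c⌉ + ⌈2|A|⌉ + 1`. Elementary real analysis; support lemma for the (P1)-type growth
comparison `l` versus `log l` of the proof of Cor. 2.2 (ii). [cite: Mochizuki2012, IUTchIV Cor 2.2 (ii) proof (P1) p.45] -/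
theorem exists_nat_forall_affine_log_le (A B c : ℝ) (hB : 0 ≤ B) (hc : 0 < c) :
    ∃ k₁ : ℕ, ∀ k : ℕ, k₁ ≤ k → ∀ x : ℝ, 0 < x → x ≤ c * k → A + B * Real.log x ≤ k := by
  refine ⟨⌈16 * B ^ 2 * c⌉₊ + ⌈2 * |A|⌉₊ + 1, fun k hk x hx hxk => ?_⟩
  have hk1 : (1 : ℝ) ≤ k := by exact_mod_cast (show 1 ≤ k by omega)
  have hkpos : (0 : ℝ) < k := by linarith
  have hck : 0 < c * k := mul_pos hc hkpos
  -- `log x ≤ log (c k) ≤ 2 √(c k)`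
  have h1 : Real.log x ≤ Real.log (c * k) := Real.log_le_log hx hxk
  have h2 : Real.log (c * k) ≤ 2 * Real.sqrt (c * k) := by
    have hs : 0 < Real.sqrt (c * k) := Real.sqrt_pos.2 hck
    have h := Real.log_le_sub_one_of_pos hs
    rw [Real.log_sqrt hck.le] at h
    linarith
  -- `2B√(ck) ≤ k/2` from `16 B² c ≤ k`, and `A ≤ k/2`
  have hk16 : 16 * B ^ 2 * c ≤ k := by
    have h1' : 16 * B ^ 2 * c ≤ ⌈16 * B ^ 2 * c⌉₊ := Nat.le_ceil _
    have h2' : ((⌈16 * B ^ 2 * c⌉₊ + ⌈2 * |A|⌉₊ + 1 : ℕ) : ℝ) ≤ k := by exact_mod_cast hk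
    push_cast at h2'
    have h3' : (0 : ℝ) ≤ ⌈2 * |A|⌉₊ := Nat.cast_nonneg _
    linarith
  have hkA : 2 * |A| ≤ k := by
    have h1' : 2 * |A| ≤ ⌈2 * |A|⌉₊ := Nat.le_ceil _
    have h2' : ((⌈16 * B ^ 2 * c⌉₊ + ⌈2 * |A|⌉₊ + 1 : ℕ) : ℝ) ≤ k := by exact_mod_cast hk
    push_cast at h2'
    have h3' : (0 : ℝ) ≤ ⌈16 * B ^ 2 * c⌉₊ := Nat.cast_nonneg _
    linarith
  have hsq : 4 * B * Real.sqrt c ≤ Real.sqrt k := by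
    have h0 : 0 ≤ 4 * B * Real.sqrt c := by positivity
    rw [show 4 * B * Real.sqrt c = Real.sqrt ((4 * B * Real.sqrt c) ^ 2) by rw [Real.sqrt_sq h0]]
    apply Real.sqrt_le_sqrt
    nlinarith [Real.sq_sqrt hc.le]
  have h3 : 2 * B * Real.sqrt (c * k) ≤ k / 2 := by
    rw [Real.sqrt_mul hc.le]
    have hsk : 0 ≤ Real.sqrt k := Real.sqrt_nonneg _
    have hkk : Real.sqrt k * Real.sqrt k = k := Real.mul_self_sqrt hkpos.le
    nlinarith
  have hA : A ≤ k / 2 := by linarith [le_abs_self A]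
  nlinarith

/-! ## Admissible primes `l = O(k)` for `λ_k` -/

/-- **ADMISSIBLE PAIRS `(λ_k, l)` WITH `11 ≤ l ≤ 60k`.** There is `k₀` such that for every `k ≥ k₀` some prime `l` with
`11 ≤ l ≤ 60·k` makes `(P, l)`, `P = ratPoint λ_k` (`λ_k = 1/2 + 2/7^k`), admissible for [IUTchIV] Cor. 2.2 (ii) / the
Theorem-1.10 interface: `P ∈ UP`, `P ∈ K_V = CBData.std {2}`, `P ∈ U^{≤1}`, `AdmitsCore P`, (P2) `CondP2 P l`, (P5) `CondP5 P l`,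
(P6) `CondP6 P l`. The prime is Bertrand's in `(N, 2N]`, `N = ⌈log(q^∀(P))/log 2⌉` — so (P2) holds by `condP2_of_lt`, and
`4k ≤ N ≤ 18k + 12` by `2k·log 7 ≤ log(q^∀(λ_k)) ≤ 6k·log 7 + 12·log 2`; (P5) at the place over `7` (a pole of `j`, `7 ∤ 2l`);
(P6) by the tree's proved (P4) ⟹ (P6) `condP6_of_seven_le` once `log(q^∀(P)) ≥ 2k·log 7` exceeds its threshold `H_K`.
[cite: Mochizuki2012, IUTchIV Cor 2.2 (ii) proof (P1)-(P7) pp.45-46] -/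
theorem exists_admissible_prime_ratPoint_lamSeven :
    ∃ k₀ : ℕ, ∀ k : ℕ, k₀ ≤ k → ∃ l : ℕ, l.Prime ∧ 11 ≤ l ∧ (l : ℝ) ≤ 60 * k ∧
      logQForall (ratPoint ((2 : ℚ)⁻¹ + 2 / 7 ^ k)) / Real.log 2 < l ∧
      ratPoint ((2 : ℚ)⁻¹ + 2 / 7 ^ k) ∈ UP ∧
      ratPoint ((2 : ℚ)⁻¹ + 2 / 7 ^ k) ∈ (CBData.std {2} (by simp [Nat.prime_two])).toSet ∧
      ratPoint ((2 : ℚ)⁻¹ + 2 / 7 ^ k) ∈ UPle 1 ∧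
      AdmitsCore (ratPoint ((2 : ℚ)⁻¹ + 2 / 7 ^ k)) ∧
      CondP2 (ratPoint ((2 : ℚ)⁻¹ + 2 / 7 ^ k)) l ∧ CondP5 (ratPoint ((2 : ℚ)⁻¹ + 2 / 7 ^ k)) l ∧
      CondP6 (ratPoint ((2 : ℚ)⁻¹ + 2 / 7 ^ k)) l := by
  have hS : ∀ p ∈ ({2} : Finset ℕ), p.Prime := by simp [Nat.prime_two]
  obtain ⟨HK, hHK⟩ := condP6_of_seven_le (CBData.std {2} hS)
  refine ⟨⌈HK⌉₊ + 2, fun k hk => ?_⟩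
  have hk1 : 1 ≤ k := by omega
  have hk2 : 2 ≤ k := by omega
  have hlog2 : (0 : ℝ) < Real.log 2 := Real.log_pos (by norm_num)
  have hlog27 : 2 * Real.log 2 ≤ Real.log 7 := by
    have h := Real.log_le_log (by norm_num : (0 : ℝ) < 2 ^ 2) (by norm_num : (2 : ℝ) ^ 2 ≤ 7)
    rw [Real.log_pow] at h
    push_cast at h
    linarith
  have hlog78 : Real.log 7 < 3 * Real.log 2 := by
    have h := Real.log_lt_log (by norm_num : (0 : ℝ) < 7) (by norm_num : (7 : ℝ) < 2 ^ 3)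
    rw [Real.log_pow] at h
    push_cast at h
    linarith
  have hlo := two_mul_log_seven_le_logQForall_lam hk1
  have hhi := logQForall_ratPoint_lamSeven_le hk1
  set h := logQForall (ratPoint ((2 : ℚ)⁻¹ + 2 / 7 ^ k)) with hhdef
  have hkR : (2 : ℝ) ≤ k := by exact_mod_cast hk2
  -- `4k ≤ h / log 2 ≤ 18k + 12`
  have hq_lo : 4 * (k : ℝ) ≤ h / Real.log 2 := by
    rw [le_div_iff₀ hlog2]; nlinarith
  have hq_hi : h / Real.log 2 ≤ 18 * k + 12 := by
    rw [div_le_iff₀ hlog2]; nlinarith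
  have hq_pos : 0 < h / Real.log 2 := by linarith
  set N : ℕ := ⌈h / Real.log 2⌉₊ with hNdef
  have hN0 : N ≠ 0 := (Nat.ceil_pos.2 hq_pos).ne'
  have hNge : h / Real.log 2 ≤ N := Nat.le_ceil _
  have hNlt : (N : ℝ) < h / Real.log 2 + 1 := Nat.ceil_lt_add_one hq_pos.le
  obtain ⟨l, hlp, hNl, hl2N⟩ := Nat.exists_prime_lt_and_le_two_mul N hN0
  -- size of `l`
  have hN8 : 8 ≤ N := by
    have : (8 : ℝ) ≤ N := by linarith
    exact_mod_cast this
  have hl9 : 9 ≤ l := by omega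
  have hl11 : 11 ≤ l := by
    rcases (show l = 9 ∨ l = 10 ∨ 11 ≤ l by omega) with h9 | h10 | h11
    · exact absurd hlp (by rw [h9]; norm_num)
    · exact absurd hlp (by rw [h10]; norm_num)
    · exact h11
  have hl7 : 7 ≤ l := by omega
  have hl60 : (l : ℝ) ≤ 60 * k := by
    have h2N : (l : ℝ) ≤ 2 * N := by exact_mod_cast hl2N
    nlinarith
  have hlt : h / Real.log 2 < l := by
    have : (N : ℝ) < l := by exact_mod_cast hNl
    linarith
  -- admissibility
  have hUP : ratPoint ((2 : ℚ)⁻¹ + 2 / 7 ^ k) ∈ UP := ratPoint_lamSeven_mem_UP hk1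
  have hmem := ratPoint_lam_mem_std_two hk2 hS
  have hU1 : ratPoint ((2 : ℚ)⁻¹ + 2 / 7 ^ k) ∈ UPle 1 :=
    ratPoint_mem_UPle_one (lamSeven_ne hk1).1 (lamSeven_ne hk1).2
  have hcore := admitsCore_ratPoint_lam hk1
  have hP2 : CondP2 (ratPoint ((2 : ℚ)⁻¹ + 2 / 7 ^ k)) l := by
    apply condP2_of_lt
    rw [degree_ratPoint, Nat.cast_one, one_mul]
    exact hlt
  have hP5 : CondP5 (ratPoint ((2 : ℚ)⁻¹ + 2 / 7 ^ k)) l := by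
    obtain ⟨v, hv⟩ := exists_place_natGenerator_eq' (show Nat.Prime 7 by norm_num)
    refine ⟨v, ord_jInv_lamSeven_neg v hv hk1, ?_, ?_⟩
    · change ¬ ((2 : ℕ) : 𝓞 ℚ) ∈ v.asIdeal
      rw [UniformABCConjecture.natCast_mem_asIdeal_iff, hv]; norm_num
    · change ¬ ((l : ℕ) : 𝓞 ℚ) ∈ v.asIdeal
      rw [UniformABCConjecture.natCast_mem_asIdeal_iff, hv]
      intro hd
      have : 7 = l := (Nat.prime_dvd_prime_iff_eq (by norm_num) hlp).1 hd
      omega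
  have hHK' : HK < h := by
    have h1 : HK ≤ ⌈HK⌉₊ := Nat.le_ceil HK
    have h2 : ((⌈HK⌉₊ + 2 : ℕ) : ℝ) ≤ k := by exact_mod_cast hk
    push_cast at h2
    have h3 : (k : ℝ) ≤ 2 * k * Real.log 7 := by nlinarith [Real.log_two_gt_d9, hlog27]
    linarith
  have hP6 : CondP6 (ratPoint ((2 : ℚ)⁻¹ + 2 / 7 ^ k)) l := hHK _ hmem hUP l hlp hl7 hP2 hP5 hHK'
  exact ⟨l, hlp, hl11, hl60, hlt, hUP, hmem, hU1, hcore, hP2, hP5, hP6⟩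

/-- **The HEX-KERNEL input in the binder order of `hSH`** (`Conditional.abc_of_SH_v6K`: `P ∈ UP → l.Prime → 5 ≤ l →
AdmitsCore P → CondP2 P l → CondP5 P l → CondP6 P l`): for every `k ≥ k₀` an admissible `(ratPoint λ_k, l)` with
`11 ≤ l ≤ 60·k`, together with the pole order `ord_v j(λ_k) = −2k` at every place `v` of `ℚ` over `7`.
[cite: Mochizuki2012, IUTchIV Cor 2.2 (ii) proof (P1)-(P7) pp.45-46] -/
theorem exists_admissible_prime_ratPoint_lamSeven_ord :
    ∃ k₀ : ℕ, 1 ≤ k₀ ∧ ∀ k : ℕ, k₀ ≤ k → ∃ l : ℕ,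
      ratPoint ((2 : ℚ)⁻¹ + 2 / 7 ^ k) ∈ UP ∧ l.Prime ∧ 5 ≤ l ∧
      AdmitsCore (ratPoint ((2 : ℚ)⁻¹ + 2 / 7 ^ k)) ∧
      CondP2 (ratPoint ((2 : ℚ)⁻¹ + 2 / 7 ^ k)) l ∧ CondP5 (ratPoint ((2 : ℚ)⁻¹ + 2 / 7 ^ k)) l ∧
      CondP6 (ratPoint ((2 : ℚ)⁻¹ + 2 / 7 ^ k)) l ∧
      11 ≤ l ∧ (l : ℝ) ≤ 60 * k ∧
      ∀ v : HeightOneSpectrum (𝓞 ℚ), Rat.HeightOneSpectrum.natGenerator v = 7 →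
        ord ℚ v (jInv ((2 : ℚ)⁻¹ + 2 / 7 ^ k)) = -(2 * k : ℤ) := by
  obtain ⟨k₀, hk₀⟩ := exists_admissible_prime_ratPoint_lamSeven
  refine ⟨max k₀ 1, le_max_right _ _, fun k hk => ?_⟩
  have hk1 : 1 ≤ k := le_trans (le_max_right _ _) hk
  obtain ⟨l, hlp, hl11, hl60, -, hUP, -, -, hcore, hP2, hP5, hP6⟩ := hk₀ k (le_trans (le_max_left _ _) hk)
  exact ⟨l, hUP, hlp, by omega, hcore, hP2, hP5, hP6, hl11, hl60, fun v hv => ord_jInv_lamSeven v hv hk1⟩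

end Cor22

end Literature.IUT.LogVolume

end
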